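import Summits.Schanuel.Schanuel.Theorems.RootDecomp1KCor52Holds01

/-!
# RootDecomp1KCor52Holds — lens 6, generation 21 «GENERAL COR. 5.2, HYPOTHESIS-FREE» (RULE K-R29 (i), FRAME G21, LANE T): the registered Literature named fact `Literature.Barriers.Schanuel.NesterenkoPhilippon2001_ch3_cor_5_2` (LNM 1752 Ch. 3 Cor. 5.2 in PRINT GENERALITY: every q with 0 < |q| < 1, every ξ ∈ ℂ³ over which q, P(q), Q(q), R(q) are algebraic) DISCHARGED BY NAME — `theorem NesterenkoPhilippon2001_ch3_cor_5_2_holds : NesterenkoPhilippon2001_ch3_cor_5_2` from tree theorems only (Thm 1.1, Thm 5.1 at r = 3, Props 4.8 / 4.11, the norm step of p. 47) — continuation (RootDecomp1KCor52Holds02): §3 the measure (31) at every dependent Ramanujan point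

(lens-6 g21 HOME kernel Cor52.lean 7faa26d9…, 1013 l, ONE import = tree RootDecomp1KPiScale01, namespace `Summit.Schanuel.Schanuel.Theorems.RootDecomp1KCor52`; CLAIM L2014, FRAME G21 L2016, NODE L2073 / RESULT L2074, critic VERDICT L2077 (crit g8: CLEARED — THEOREM ×1, the registered Literature fact discharged BY NAME in print generality; lens-6 tally THEOREM ×4 + CELL ×3; PORT NOW Summit-side, `--supports stmt-Schanuel-33363` = the PiCells/Hyper consumers it un-conditions; Literature relocation = later ops hoist of the four Summit helpers); Summit-side home because the kernel uses Summit helpers (`mvlen` algebra Hyper03/42, det bounds Hyper47, `natAbs_coeff_sup_le_mvlen` PiCells, `norm_mvaeval_le_mvlen_mul_pow` RelLiouvilleCell01) — NODE-g21.md §5; port by census-1 gen 18 as `RootDecomp1KCor52Holds01`–`05`: 01 = §1 transcendence-degree bookkeeping (`Kq`, `Lq`, `bookkeeping`) + §2 a dependent Ramanujan point lies on a prime form (`exists_prime_form_of_dependent`, `span_prime_form`); 02 = §3 the measure (31) at EVERY dependent Ramanujan point (`measure31_of_dependent`); 03 = §4 norm-step algebra (`exists_int_frac`, `exists_common_den`,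 `EB` entry bounds, `wt`, `matA`, `EB_matA`, `det_matA_bounds`) + §4d the evaluation identity (`ringHom_aeval_eq_sum`, `mapMatrix_matA`); 04 = §4e `norm_step_algebra` (B := det 𝔄_A, B(ω) = δ^{nD}·N_{L/K}(A(ξ))); 05 = §4e `norm_step` (analysis) + §5 `NesterenkoPhilippon2001_ch3_cor_5_2_holds` and the binder-free `{π, e^π, Γ(1/4)}` clause `NesterenkoPhilippon2001_ch3_cor_5_2_pi`.
PORT EDITS: `set_option linter.dupNamespace false` dropped; twelve one-line docstrings added; six generic helpers made `private` (`trdeg_adjoin_le_of_isAlgebraic`, `isAlgebraic_of_mem_adjoin`, `four_le_trdeg_of_algebraicIndependent`, `one_le_log_of_exp_le`, `ringHom_mvaeval`, `mapMatrix_smul` — tree twins exist) with per-part private copies; the three scoped `synthInstance.maxHeartbeats 400000 in` and `attribute [local instance] MvPolynomial.gradedAlgebra` kept (precedent PiScale01); statements and proofs verbatim. `--supports stmt-Schanuel-33363`; no census credit carried; rung 0 — nothing here proves Schanuel.)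
-/

noncomputable section

open Complex IntermediateField
open MvPolynomial (aeval rename X C)
open Literature.NumberTheory.Transcendental
open Literature.NumberTheory.Transcendental.Nesterenko
open Literature.Barriers.Schanuel
open Summit.Schanuel.Schanuel.Theorems.RootDecomp1KHyper

attribute [local instance] MvPolynomial.gradedAlgebra

namespace Summit.Schanuel.Schanuel.Theorems.RootDecomp1KCor52

/-! ## §3  The measure (31) at EVERY dependent Ramanujan point (LNM 1752 Ch. 3, p. 47, (31)):
`exp(−c T⁴ log²⁴ T) ≤ |B(ω)|` for `B ∈ ℤ[y₁,…,y₄]` with `B(ω) ≠ 0`, `T ≥ max (deg B + log H(B)) e` -/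

/-- `x ^ (4:ℝ) = x ^ 4`. -/
private theorem rpow_four (T : ℝ) : T ^ ((4 : ℝ) / (4 - ((3 : ℕ) : ℝ))) = T ^ (4 : ℕ) := by
  rw [show ((4 : ℝ) / (4 - ((3 : ℕ) : ℝ))) = ((4 : ℕ) : ℝ) by norm_num, Real.rpow_natCast]

/-- `x ^ (24:ℝ) = x ^ 24`. -/
private theorem rpow_twentyfour (L : ℝ) :
    L ^ ((8 : ℝ) * ((3 : ℕ) : ℝ) / (4 - ((3 : ℕ) : ℝ))) = L ^ (24 : ℕ) := by
  rw [show ((8 : ℝ) * ((3 : ℕ) : ℝ) / (4 - ((3 : ℕ) : ℝ))) = ((24 : ℕ) : ℝ) by norm_num, Real.rpow_natCast]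

/-- `1 ≤ log T` for `e ≤ T`. -/
private theorem one_le_log_of_exp_le {x : ℝ} (hx : Real.exp 1 ≤ x) : 1 ≤ Real.log x := by
  rw [← Real.log_exp 1]; exact Real.log_le_log (Real.exp_pos 1) hx

/-- **(31) at every algebraically dependent Ramanujan point** `ω = (q, P(q), Q(q), R(q))`, `0 < |q| < 1`:
`∃ c > 0, ∀ B ∈ ℤ[y₁,…,y₄], B(ω) ≠ 0 → ∀ T ≥ max (deg B + log H(B)) e, exp(−c T⁴ log²⁴ T) ≤ |B(ω)|` — from the
tree-proved Theorem 5.1 (`r = 3`), Prop. 4.11 (`𝔭 = (p)`, `p` a prime form vanishing at `ω̄`, `Q =` the homogenisation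
of `B`, `Q ∉ (p)` because `Q(ω̄) = B(ω) ≠ 0`) and Prop. 4.8 (`|(p)(ω̄)| = 0`).
[cite: NesterenkoPhilippon2001, Ch. 3 Cor. 5.2 proof, (31) (p. 47)] -/
theorem measure31_of_dependent (q : ℂ) (hq0 : 0 < ‖q‖) (hq1 : ‖q‖ < 1)
    (hdep : ¬ AlgebraicIndependent ℚ (ramanujanPoint q)) :
    ∃ c : ℝ, 0 < c ∧ ∀ B : MvPolynomial (Fin 4) ℤ, aeval (ramanujanPoint q) B ≠ 0 → ∀ T : ℝ,
      max ((B.totalDegree : ℝ) + Real.log (mvPolyHeight B)) (Real.exp 1) ≤ T →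
        Real.exp (-(c * T ^ 4 * Real.log T ^ 24)) ≤ ‖aeval (ramanujanPoint q) B‖ := by
  obtain ⟨μ, hμ, h51⟩ := NesterenkoPhilippon2001_ch3_thm_5_1_holds q hq0 hq1 3 (by norm_num) le_rfl
  obtain ⟨p, hprime, hphom, hdF1, hpval⟩ := exists_prime_form_of_dependent q hdep
  obtain ⟨hPpr, hPhom, hPunm, hdegP, hh₀nn, hiabs⟩ := span_prime_form q hprime hphom hpval
  set P : Ideal (Rx 4) := Ideal.span {p} with hPdef
  set dF : ℕ := p.totalDegree with hdFdef
  have hdF1r : (1 : ℝ) ≤ dF := by exact_mod_cast hdF1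
  have hdF0r : (0 : ℝ) ≤ dF := by linarith
  set h₀ : ℝ := iheight P 4 with hh₀
  set c₁ : ℝ := h₀ + 22 * dF + 2 with hc₁
  have hc₁pos : 0 < c₁ := by rw [hc₁]; linarith
  have hc₁one : 1 ≤ c₁ := by rw [hc₁]; linarith
  have hlogc₁ : 0 ≤ Real.log c₁ := Real.log_nonneg hc₁one
  have h177 : 0 ≤ h₀ + 177 * dF := by positivity
  refine ⟨μ * c₁ ^ 4 * (1 + Real.log c₁) ^ 24 + (h₀ + 177 * dF), by positivity, ?_⟩
  intro B hB T hT
  have hB0 : B ≠ 0 := fun h => hB (by rw [h, map_zero])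
  have hTe : Real.exp 1 ≤ T := le_trans (le_max_right _ _) hT
  have hT1 : 1 ≤ T := le_trans (by have := Real.add_one_le_exp (1 : ℝ); linarith) hTe
  have hT0 : 0 < T := by linarith
  have hlogT : 1 ≤ Real.log T := one_le_log_of_exp_le hTe
  have hH1 : 1 ≤ mvPolyHeight B := PhilipponMain.one_le_mvPolyHeight hB0
  have hH1r : (1 : ℝ) ≤ mvPolyHeight B := by exact_mod_cast hH1
  have hlogH : 0 ≤ Real.log (mvPolyHeight B) := Real.log_nonneg hH1r
  have hnT : (B.totalDegree : ℝ) + Real.log (mvPolyHeight B) ≤ T := le_trans (le_max_left _ _) hT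
  have hn0' : (0 : ℝ) ≤ B.totalDegree := Nat.cast_nonneg _
  have hexp_le_one : Real.exp (-((μ * c₁ ^ 4 * (1 + Real.log c₁) ^ 24 + (h₀ + 177 * dF)) * T ^ 4 *
      Real.log T ^ 24)) ≤ 1 := by
    rw [Real.exp_le_one_iff, neg_nonpos]; positivity
  rcases Nat.eq_zero_or_pos B.totalDegree with hn0 | hn1
  · -- constant polynomial: `|B(ω)| = |c| ≥ 1`
    have hBC : B = C (B.coeff 0) := MvPolynomial.totalDegree_eq_zero_iff_eq_C.mp hn0
    have hc0 : B.coeff 0 ≠ 0 := fun h => hB0 (by rw [hBC, h, map_zero])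
    rw [hBC, MvPolynomial.aeval_C, algebraMap_int_eq, eq_intCast, Complex.norm_intCast]
    refine le_trans hexp_le_one ?_
    rw [← Int.cast_abs]; exact_mod_cast Int.one_le_abs hc0
  · -- main case `n = deg B ≥ 1`
    obtain ⟨E, hEhom, hEval, hEmax, hEht, hEnz⟩ := exists_homogenization B (le_refl B.totalDegree)
    obtain ⟨hE0, hEdeg⟩ := hEnz hB0
    -- the value: `B(ω) = E(ω̄)`
    have hvalE : aeval (nesterenkoOmega q) E = aeval (ramanujanPoint q) B := by
      rw [hEval _ (nesterenkoOmega_zero _), ramanujanPoint_eq_nesterenkoOmega_succ]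
    have hEnot : E ∉ P := by
      intro hmem
      obtain ⟨D, hD⟩ := Ideal.mem_span_singleton'.mp hmem
      apply hB
      rw [← hvalE, ← hD, map_mul, hpval, mul_zero]
    obtain ⟨J, hJhom, hJunm, -, hJdeg, hJht, hJabs⟩ :=
      (NesterenkoPhilippon2001_ch3_prop_4_11_holds 4 4 P E B.totalDegree (by norm_num) le_rfl
        hPpr hPhom hPunm hEhom hn1 hEnot).1 (by norm_num)
    rw [hdegP] at hJdeg hJht hJabs
    -- heights of `E`
    have hmaxE : 1 ≤ maxNorm E := by rw [hEmax]; exact hH1r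
    have hhtE : height E ≤ Real.log (mvPolyHeight B) := hEht
    have hhtE0 : 0 ≤ height E := height_nonneg _
    have hhtT : height E ≤ T := by linarith
    have hnT' : (B.totalDegree : ℝ) ≤ T := by linarith
    -- Theorem 5.1 at `J`, `T₀ := max (h(J) + deg J) e`
    set T₀ : ℝ := max (iheight J 3 + ideg J 3) (Real.exp 1) with hT₀
    have hJunm3 : IsUnmixedOfRank J 3 := hJunm
    have h51J := h51 J hJhom hJunm3 T₀ le_rfl
    rw [rpow_four, rpow_twentyfour] at h51J
    have hT₀e : Real.exp 1 ≤ T₀ := le_max_right _ _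
    have hT₀pos : 0 < T₀ := lt_of_lt_of_le (Real.exp_pos 1) hT₀e
    have hlogT₀ : 1 ≤ Real.log T₀ := one_le_log_of_exp_le hT₀e
    -- products with the fixed degree `dF`
    have hdn : (dF : ℝ) * B.totalDegree ≤ dF * T := mul_le_mul_of_nonneg_left hnT' hdF0r
    have hdE : (dF : ℝ) * height E ≤ dF * T := mul_le_mul_of_nonneg_left hhtT hdF0r
    have h1n : h₀ * (B.totalDegree : ℝ) ≤ h₀ * T := mul_le_mul_of_nonneg_left hnT' hh₀nn
    have hh₀T : 0 ≤ h₀ * T := mul_nonneg hh₀nn hT0.le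
    have hdT0 : 0 ≤ (dF : ℝ) * T := mul_nonneg hdF0r hT0.le
    -- `T₀ ≤ c₁ T`
    have hJdeg' : (ideg J 3 : ℝ) ≤ dF * B.totalDegree := by exact_mod_cast hJdeg
    have hJht' : iheight J 3 ≤ h₀ * B.totalDegree + dF * height E + 20 * (dF * B.totalDegree) := by
      have h' : iheight J 3 ≤ iheight P 4 * (B.totalDegree : ℝ) + height E * ((dF : ℕ) : ℝ) +
          ((4 : ℕ) : ℝ) * (((4 : ℕ) : ℝ) + 1) * ((dF : ℕ) : ℝ) * (B.totalDegree : ℝ) := hJht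
      rw [← hh₀] at h'
      simp only [Nat.cast_ofNat] at h'
      nlinarith only [h']
    have hT₀le : T₀ ≤ c₁ * T := by
      refine max_le ?_ ?_
      · rw [hc₁]; nlinarith only [hJht', hJdeg', h1n, hdn, hdE, hnT', hT0, hT1, hh₀T, hdT0]
      · rw [hc₁]; nlinarith only [hTe, hh₀T, hT0, hdT0, hT1]
    -- `δ ≤ ‖E‖_ω̄`
    have hδ : bezoutDelta P 4 E (nesterenkoOmega q) ≤ normAt (nesterenkoOmega q) E := by
      have := bezoutDelta_le_max P 4 E (nesterenkoOmega q)
      rwa [hiabs, max_eq_left (normAt_nonneg _ _)] at this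
    have hJabs' := hJabs (nesterenkoOmega q) (nesterenkoOmega_ne_zero _)
    -- chain: exp(−μ T₀⁴ log²⁴ T₀) ≤ |J(ω̄)| ≤ ‖E‖_ω̄ · exp Ξ,  Ξ ≤ (h₀ + 177 dF) T
    have hΞ : height E * ((dF : ℕ) : ℝ) + iheight P 4 * (B.totalDegree : ℝ) +
        11 * ((4 : ℕ) : ℝ) ^ 2 * ((dF : ℕ) : ℝ) * (B.totalDegree : ℝ) ≤ (h₀ + 177 * dF) * T := by
      rw [← hh₀]
      simp only [Nat.cast_ofNat]
      nlinarith only [h1n, hdE, hdn, hT0, hh₀T, hdT0]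
    have hchain : Real.exp (-(μ * T₀ ^ 4 * Real.log T₀ ^ 24)) ≤
        normAt (nesterenkoOmega q) E * Real.exp ((h₀ + 177 * dF) * T) :=
      le_trans h51J (le_trans hJabs' (mul_le_mul hδ (Real.exp_le_exp.mpr hΞ)
        (Real.exp_pos _).le (normAt_nonneg _ _)))
    -- the main exponent comparison
    set κ : ℝ := (1 + Real.log c₁) ^ 24 with hκ
    have hκ1 : 1 ≤ κ := one_le_pow₀ (by linarith)
    have hlogcT : Real.log (c₁ * T) ≤ (1 + Real.log c₁) * Real.log T := by
      rw [Real.log_mul hc₁pos.ne' hT0.ne']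
      have h := mul_le_mul_of_nonneg_left hlogT hlogc₁
      linarith only [h]
    have hlogT₀le : Real.log T₀ ≤ (1 + Real.log c₁) * Real.log T :=
      le_trans (Real.log_le_log hT₀pos hT₀le) hlogcT
    have hpow4 : T₀ ^ 4 ≤ c₁ ^ 4 * T ^ 4 := by
      rw [← mul_pow]; exact pow_le_pow_left₀ hT₀pos.le hT₀le 4
    have hpow24 : Real.log T₀ ^ 24 ≤ κ * Real.log T ^ 24 := by
      rw [hκ, ← mul_pow]; exact pow_le_pow_left₀ (by linarith) hlogT₀le 24
    have hA : μ * T₀ ^ 4 ≤ μ * (c₁ ^ 4 * T ^ 4) := mul_le_mul_of_nonneg_left hpow4 hμ.le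
    have hmain' : μ * T₀ ^ 4 * Real.log T₀ ^ 24 ≤ μ * (c₁ ^ 4 * T ^ 4) * (κ * Real.log T ^ 24) :=
      mul_le_mul hA hpow24 (pow_nonneg (by linarith) _) (by positivity)
    have hmain : μ * T₀ ^ 4 * Real.log T₀ ^ 24 ≤ μ * c₁ ^ 4 * κ * T ^ 4 * Real.log T ^ 24 := by
      calc μ * T₀ ^ 4 * Real.log T₀ ^ 24 ≤ μ * (c₁ ^ 4 * T ^ 4) * (κ * Real.log T ^ 24) := hmain'
        _ = μ * c₁ ^ 4 * κ * T ^ 4 * Real.log T ^ 24 := by ring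
    have hlin : (h₀ + 177 * dF) * T ≤ (h₀ + 177 * dF) * T ^ 4 * Real.log T ^ 24 := by
      have h1 : T ≤ T ^ 4 := by
        calc T = T ^ 1 := (pow_one T).symm
          _ ≤ T ^ 4 := pow_le_pow_right₀ hT1 (by norm_num)
      have h2 : T ^ 4 ≤ T ^ 4 * Real.log T ^ 24 :=
        le_mul_of_one_le_right (by positivity) (one_le_pow₀ hlogT)
      calc (h₀ + 177 * dF) * T ≤ (h₀ + 177 * dF) * (T ^ 4 * Real.log T ^ 24) :=
            mul_le_mul_of_nonneg_left (le_trans h1 h2) h177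
        _ = (h₀ + 177 * dF) * T ^ 4 * Real.log T ^ 24 := by ring
    have hsum : μ * T₀ ^ 4 * Real.log T₀ ^ 24 + (h₀ + 177 * dF) * T ≤
        (μ * c₁ ^ 4 * κ + (h₀ + 177 * dF)) * T ^ 4 * Real.log T ^ 24 := by
      have : (μ * c₁ ^ 4 * κ + (h₀ + 177 * dF)) * T ^ 4 * Real.log T ^ 24 =
          μ * c₁ ^ 4 * κ * T ^ 4 * Real.log T ^ 24 + (h₀ + 177 * dF) * T ^ 4 * Real.log T ^ 24 := by ring
      rw [this]; exact add_le_add hmain hlin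
    -- conclude
    have hfin : Real.exp (-((μ * c₁ ^ 4 * κ + (h₀ + 177 * dF)) * T ^ 4 * Real.log T ^ 24)) ≤
        normAt (nesterenkoOmega q) E := by
      have hpos : 0 < Real.exp ((h₀ + 177 * dF) * T) := Real.exp_pos _
      have h1 : Real.exp (-(μ * T₀ ^ 4 * Real.log T₀ ^ 24)) / Real.exp ((h₀ + 177 * dF) * T) ≤
          normAt (nesterenkoOmega q) E := (div_le_iff₀ hpos).mpr hchain
      refine le_trans ?_ h1
      rw [← Real.exp_sub, Real.exp_le_exp]
      linarith only [hsum]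
    calc Real.exp (-((μ * c₁ ^ 4 * κ + (h₀ + 177 * dF)) * T ^ 4 * Real.log T ^ 24))
        ≤ normAt (nesterenkoOmega q) E := hfin
      _ ≤ ‖aeval (nesterenkoOmega q) E‖ := normAt_le_norm_aeval _ _ hmaxE (one_le_norm_nesterenkoOmega _)
      _ = ‖aeval (ramanujanPoint q) B‖ := by rw [hvalE]

end Summit.Schanuel.Schanuel.Theorems.RootDecomp1KCor52

end
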